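import Mathlib
import Summits.Ventures.PercRepro.PuncturedLYMSplit
import Summits.Ventures.PercRepro.PuncturedLYMCoHyp

/-!
# PercRepro — (SP) FOR PAIRWISE DISJOINT CO-HYPERPLANE FAMILIES: THE TYPE LIFT
(p10, gen 39)

For a family of members `C i ⊆ S` (`i : Fin k`) the TYPE of a set `X` is the vector of intersection counts
`typ C X = fun i => #(X ∩ C i)` together with its free count `fc C X = #(X ∩ F)`, `F = S ∖ ⋃ C i`.  A weight
function `W : (Fin k → ℕ) → ℕ → Option (Fin k) → ℚ` on (row type, free count, direction of the added point) LIFTS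
to a weight `lift W C X Y` on the inclusion pairs `X ⊂ Y`, `Y = insert y X`: the value `W (typ C X) (fc C X) (some i)`
when `y ∈ C i` and `W (typ C X) (fc C X) none` when `y ∈ F` (`dirW`).

* `hasFlow_of_typeWeights` — THE LIFT: if the row sums and column sums of the lift, computed from the type data
  (`rowSum`, `colSum`), are the prescribed `ρ`, `ν`, the instance has a flow.  No hypothesis on `C`.
* `rowSum_eq` — the row sum at `X` is `Σ_i (#(C i) − typ C X i) · W (typ C X) (fc C X) (some i) +
  (#F − fc C X) · W (typ C X) (fc C X) none` (pairwise disjoint members).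
* the type bookkeeping of `Y.erase y` (`typ_erase_of_mem`, `fc_erase_of_free`, …) for pairwise disjoint members.
The column sums at the punctured level of a family and the type constraints of its rows are in
PuncturedLYMTypeLiftFamily; together they reduce (SP) for a pairwise disjoint family with given sizes on `n`
points to a finite system of rational equations indexed by the TYPES — a certificate a kernel can check.
Nothing here asserts (SP).
-/

namespace PercRepro.PuncturedLYM.Split.TypeLift

open Finset

variable {α : Type} [DecidableEq α] [Fintype α] {k : ℕ}

/-! ### Types, free points, directions -/

/-- The type of `X` relative to the members `C`: the intersection counts. -/
def typ (C : Fin k → Finset α) (X : Finset α) : Fin k → ℕ := fun i => (X ∩ C i).card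

/-- The free points: the points in no member. -/
def freeSet (C : Fin k → Finset α) : Finset α := univ \ (univ : Finset (Fin k)).biUnion C

/-- The free count of `X`. -/
def fc (C : Fin k → Finset α) (X : Finset α) : ℕ := (X ∩ freeSet C).card

/-- The weight of the pair `(X, insert y X)` read off the type of `X` and the direction of `y`. -/
def dirW (W : (Fin k → ℕ) → ℕ → Option (Fin k) → ℚ) (C : Fin k → Finset α) (X : Finset α) (y : α) : ℚ :=
  (∑ i, if y ∈ C i then W (typ C X) (fc C X) (some i) else 0) +
    (if y ∈ freeSet C then W (typ C X) (fc C X) none else 0)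

/-- The lifted weight on a pair `(X, Y)`: the direction weight of the points of `Y ∖ X`. -/
def lift (W : (Fin k → ℕ) → ℕ → Option (Fin k) → ℚ) (C : Fin k → Finset α) (X Y : Finset α) : ℚ :=
  ∑ y ∈ Y \ X, dirW W C X y

/-- The row sum of the lift at `X` (all points of `S` outside `X`). -/
def rowSum (W : (Fin k → ℕ) → ℕ → Option (Fin k) → ℚ) (C : Fin k → Finset α) (X : Finset α) : ℚ :=
  ∑ y ∈ univ \ X, dirW W C X y

/-- The column sum of the lift at `Y` over the rows `Y ∖ y ∈ P`. -/
def colSum (W : (Fin k → ℕ) → ℕ → Option (Fin k) → ℚ) (C : Fin k → Finset α) (P : Finset (Finset α))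
    (Y : Finset α) : ℚ :=
  ∑ y ∈ Y.filter (fun y => Y.erase y ∈ P), dirW W C (Y.erase y) y

/-- A nonnegative `W` lifts to nonnegative direction weights. -/
theorem dirW_nonneg {W : (Fin k → ℕ) → ℕ → Option (Fin k) → ℚ} (hW : ∀ a c d, 0 ≤ W a c d)
    (C : Fin k → Finset α) (X : Finset α) (y : α) : 0 ≤ dirW W C X y := by
  unfold dirW
  apply add_nonneg
  · exact sum_nonneg (fun i _ => by split_ifs <;> simp [hW])
  · split_ifs <;> simp [hW]

omit [Fintype α] in
/-- `insert y X ∖ X = {y}` for `y ∉ X`. -/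
theorem insert_sdiff_self_eq {X : Finset α} {y : α} (hy : y ∉ X) : insert y X \ X = {y} := by
  ext z
  simp only [mem_sdiff, mem_insert, mem_singleton]
  constructor
  · rintro ⟨h | h, hz⟩
    · exact h
    · exact absurd h hz
  · rintro rfl; exact ⟨Or.inl rfl, hy⟩

omit [Fintype α] in
/-- `Y ∖ Y.erase y = {y}` for `y ∈ Y`. -/
theorem sdiff_erase_self_eq {Y : Finset α} {y : α} (hy : y ∈ Y) : Y \ Y.erase y = {y} := by
  ext z
  simp only [mem_sdiff, mem_erase, not_and, mem_singleton]
  constructor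
  · rintro ⟨hz, h⟩
    by_contra hne
    exact h hne hz
  · rintro rfl; exact ⟨hy, fun h _ => absurd rfl h⟩

/-- The lift on the pair `(X, insert y X)` is the direction weight of `y`. -/
theorem lift_insert (W : (Fin k → ℕ) → ℕ → Option (Fin k) → ℚ) (C : Fin k → Finset α) {X : Finset α} {y : α}
    (hy : y ∉ X) : lift W C X (insert y X) = dirW W C X y := by
  unfold lift
  rw [insert_sdiff_self_eq hy, sum_singleton]

/-- The lift on the pair `(Y.erase y, Y)` is the direction weight of `y`. -/
theorem lift_erase (W : (Fin k → ℕ) → ℕ → Option (Fin k) → ℚ) (C : Fin k → Finset α) {Y : Finset α} {y : α}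
    (hy : y ∈ Y) : lift W C (Y.erase y) Y = dirW W C (Y.erase y) y := by
  unfold lift
  rw [sdiff_erase_self_eq hy, sum_singleton]

omit [Fintype α] in
/-- The rows below a `(j+1)`-set `Y` among the `j`-sets of `P` are the `Y.erase y` that lie in `P`. -/
theorem subs_eq_image_erase {j : ℕ} {P : Finset (Finset α)} (hP : ∀ X ∈ P, X.card = j) {Y : Finset α}
    (hY : Y.card = j + 1) :
    subs P Y = (Y.filter (fun y => Y.erase y ∈ P)).image (fun y => Y.erase y) := by
  ext X
  rw [mem_subs, mem_image]
  constructor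
  · rintro ⟨hXP, hXY⟩
    have hc : (Y \ X).card = 1 := by
      rw [card_sdiff_of_subset hXY, hY, hP X hXP]; simp
    obtain ⟨y, hy⟩ := card_eq_one.1 hc
    have hyY : y ∈ Y := (mem_sdiff.1 (hy ▸ mem_singleton_self y)).1
    have hX : X = Y.erase y := by
      ext z
      rw [mem_erase]
      constructor
      · intro hz
        refine ⟨?_, hXY hz⟩
        rintro rfl
        have := hy ▸ mem_singleton_self z
        exact (mem_sdiff.1 this).2 hz
      · rintro ⟨hzy, hzY⟩
        by_contra hzX
        have : z ∈ Y \ X := mem_sdiff.2 ⟨hzY, hzX⟩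
        rw [hy, mem_singleton] at this
        exact hzy this
    exact ⟨y, mem_filter.2 ⟨hyY, hX ▸ hXP⟩, hX.symm⟩
  · rintro ⟨y, hy, rfl⟩
    exact ⟨(mem_filter.1 hy).2, erase_subset y Y⟩

/-- **THE LIFT.** If the row sums and the column sums of the lift of `W` are `ρ` and `ν`, the instance
`(univ, j, P, ρ, ν)` has a flow. -/
theorem hasFlow_of_typeWeights (C : Fin k → Finset α) {j : ℕ} {P : Finset (Finset α)} (hP : ∀ X ∈ P, X.card = j)
    (ρ ν : Finset α → ℚ) (W : (Fin k → ℕ) → ℕ → Option (Fin k) → ℚ) (hW : ∀ a c d, 0 ≤ W a c d)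
    (hrow : ∀ X ∈ P, rowSum W C X = ρ X) (hcol : ∀ Y ∈ cols univ j, colSum W C P Y = ν Y) :
    HasFlow univ j P ρ ν := by
  refine ⟨lift W C, ?_, ?_, ?_⟩
  · intro X Y
    exact sum_nonneg (fun y _ => dirW_nonneg hW C X y)
  · intro X hX
    rw [← hrow X hX, sum_sups]
    unfold rowSum
    refine sum_congr rfl (fun y hy => ?_)
    exact lift_insert W C (mem_sdiff.1 hy).2
  · intro Y hY
    rw [← hcol Y hY]
    have hYc : Y.card = j + 1 := (mem_cols.1 hY).2
    rw [subs_eq_image_erase hP hYc, sum_image (fun y hy z hz h => erase_injOn Y (mem_filter.1 hy).1 (mem_filter.1 hz).1 h)]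
    unfold colSum
    refine sum_congr rfl (fun y hy => ?_)
    exact lift_erase W C (mem_filter.1 hy).1

/-! ### The type reduction for pairwise disjoint members -/

/-- A point of a member lies in no other member and is not free. -/
theorem notMem_freeSet_of_mem {C : Fin k → Finset α} {i : Fin k} {y : α} (hy : y ∈ C i) : y ∉ freeSet C := by
  unfold freeSet
  rw [mem_sdiff, not_and, not_not]
  intro _
  exact mem_biUnion.2 ⟨i, mem_univ i, hy⟩

/-- A point is free iff it lies in no member. -/
theorem mem_freeSet {C : Fin k → Finset α} {y : α} : y ∈ freeSet C ↔ ∀ i, y ∉ C i := by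
  unfold freeSet
  simp [mem_sdiff, mem_biUnion]

/-- The direction weight of a point of the member `C i` (pairwise disjoint members). -/
theorem dirW_of_mem (W : (Fin k → ℕ) → ℕ → Option (Fin k) → ℚ) {C : Fin k → Finset α}
    (hdisj : ∀ i l, i ≠ l → Disjoint (C i) (C l)) (X : Finset α) {i : Fin k} {y : α} (hy : y ∈ C i) :
    dirW W C X y = W (typ C X) (fc C X) (some i) := by
  unfold dirW
  rw [if_neg (notMem_freeSet_of_mem hy), add_zero]
  rw [sum_eq_single i]
  · rw [if_pos hy]
  · intro l _ hli
    rw [if_neg]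
    intro hyl
    exact disjoint_left.1 (hdisj i l (Ne.symm hli)) hy hyl
  · intro h; exact absurd (mem_univ i) h

/-- The direction weight of a free point. -/
theorem dirW_of_free (W : (Fin k → ℕ) → ℕ → Option (Fin k) → ℚ) (C : Fin k → Finset α) (X : Finset α) {y : α}
    (hy : y ∈ freeSet C) : dirW W C X y = W (typ C X) (fc C X) none := by
  unfold dirW
  rw [if_pos hy, sum_eq_zero, zero_add]
  intro i _
  rw [if_neg]
  intro hyi
  exact (mem_freeSet.1 hy) i hyi

/-- The row sum at `X`, in the type data. -/
theorem rowSum_eq (W : (Fin k → ℕ) → ℕ → Option (Fin k) → ℚ) (C : Fin k → Finset α) (X : Finset α) :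
    rowSum W C X = ∑ i, ((C i \ X).card : ℚ) * W (typ C X) (fc C X) (some i) +
      ((freeSet C \ X).card : ℚ) * W (typ C X) (fc C X) none := by
  unfold rowSum dirW
  rw [sum_add_distrib, sum_comm]
  congr 1
  · refine sum_congr rfl (fun i _ => ?_)
    have h : (univ \ X).filter (fun y => y ∈ C i) = C i \ X := by
      ext z
      simp only [mem_filter, mem_sdiff, mem_univ, true_and]
      tauto
    rw [← sum_filter, sum_const, nsmul_eq_mul, h]
  · have h : (univ \ X).filter (fun y => y ∈ freeSet C) = freeSet C \ X := by
      ext z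
      simp only [mem_filter, mem_sdiff, mem_univ, true_and]
      tauto
    rw [← sum_filter, sum_const, nsmul_eq_mul, h]

omit [Fintype α] in
/-- `#(C i ∖ X) = #(C i) − typ C X i`. -/
theorem card_sdiff_eq_sub_typ (C : Fin k → Finset α) (X : Finset α) (i : Fin k) :
    (C i \ X).card = (C i).card - typ C X i := by
  unfold typ
  have h := card_sdiff_add_card_inter (C i) X
  rw [inter_comm] at h
  omega

/-- `#(F ∖ X) = #F − fc C X`. -/
theorem card_freeSet_sdiff (C : Fin k → Finset α) (X : Finset α) :
    (freeSet C \ X).card = (freeSet C).card - fc C X := by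
  unfold fc
  have h := card_sdiff_add_card_inter (freeSet C) X
  rw [inter_comm] at h
  omega

omit [Fintype α] in
/-- `(Y.erase y) ∩ T = (Y ∩ T).erase y`. -/
theorem erase_inter_eq (Y T : Finset α) (y : α) : (Y.erase y) ∩ T = (Y ∩ T).erase y := by
  ext z
  simp only [mem_inter, mem_erase]
  tauto

omit [Fintype α] in
/-- The type of `Y.erase y` for `y ∈ Y ∩ C i`: the `i`-coordinate drops by one, the others are unchanged
(pairwise disjoint members). -/
theorem typ_erase_of_mem {C : Fin k → Finset α} (hdisj : ∀ i l, i ≠ l → Disjoint (C i) (C l)) {Y : Finset α}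
    {i : Fin k} {y : α} (hyY : y ∈ Y) (hy : y ∈ C i) :
    typ C (Y.erase y) = Function.update (typ C Y) i (typ C Y i - 1) := by
  funext l
  unfold typ
  by_cases hli : l = i
  · subst hli
    rw [Function.update_self, erase_inter_eq, card_erase_of_mem (mem_inter.2 ⟨hyY, hy⟩)]
  · rw [Function.update_of_ne hli, erase_inter_eq, erase_eq_of_notMem]
    rw [mem_inter, not_and]
    intro _ hyl
    exact disjoint_left.1 (hdisj l i hli) hyl hy

/-- The free count of `Y.erase y` for `y` in a member: unchanged. -/
theorem fc_erase_of_mem (C : Fin k → Finset α) (Y : Finset α) {i : Fin k} {y : α} (hy : y ∈ C i) :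
    fc C (Y.erase y) = fc C Y := by
  unfold fc
  rw [erase_inter_eq, erase_eq_of_notMem]
  rw [mem_inter, not_and]
  intro _ hyf
  exact notMem_freeSet_of_mem hy hyf

/-- The type of `Y.erase y` for a free point `y`: unchanged. -/
theorem typ_erase_of_free (C : Fin k → Finset α) (Y : Finset α) {y : α} (hy : y ∈ freeSet C) :
    typ C (Y.erase y) = typ C Y := by
  funext l
  unfold typ
  rw [erase_inter_eq, erase_eq_of_notMem]
  rw [mem_inter, not_and]
  intro _ hyl
  exact (mem_freeSet.1 hy) l hyl

/-- The free count of `Y.erase y` for a free point `y ∈ Y`: drops by one. -/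
theorem fc_erase_of_free (C : Fin k → Finset α) {Y : Finset α} {y : α} (hyY : y ∈ Y) (hy : y ∈ freeSet C) :
    fc C (Y.erase y) = fc C Y - 1 := by
  unfold fc
  rw [erase_inter_eq, card_erase_of_mem (mem_inter.2 ⟨hyY, hy⟩)]

end PercRepro.PuncturedLYM.Split.TypeLift
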